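import Mathlib.Analysis.Complex.ExponentialBounds
import Literature.NumberTheory.Transcendental.LWMeasureSmallnessComposite
import HarnessLib

/-!
# The auxiliary polynomials of the Lindemann–Weierstrass measure (Ably 1994, §II) — sizes of the family at the final parameters

`Literature/NumberTheory/Transcendental/LWMeasureFamilySizes.lean` — proofs only, no named facts,
no definitions. Companion of `LWMeasureConstruction.lean` in the proof of Ably's "Proposition
principale" (§II of M. Ably, Acta Arith. 67 (1994)) behind the named fact
`Ably1994_lindemannWeierstrass_measure` (`LindemannWeierstrassMeasure.lean`): the degree and height
estimates (9), (10), p. 41, of the family `{Q_{s,h,j}} ∪ {μ(w)}` under the final parameter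
relations (`M ≥ M₀`, `Mⁿ ≤ L`, `D ≤ 2^{n+4} d`, `b ≤ DM`, `T'Mⁿ ≤ 8L`, `sMⁿ ≤ c_ST L`,
`Mⁿ L log M ≤ R`, `L log L ≤ 4R`, `H ≤ LDbⁿ (L+D)^{T'} K₁(M)^L`) — `deg ≤ c_δ M` and
`log ‖·‖₁ ≤ c_τ R / Mⁿ` with `c_δ, c_τ` depending on the data `S` and on `c_ST` only
(`Setup.family_sizes`) — read off `Setup.totalDegree_Qj_le`, `Setup.l1_Qj_le`,
`totalDegree_toW_le`, `l1_toW_le` by elementary bookkeeping of logarithms.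

## References

* [Ably1994] M. Ably, *Une version quantitative du théorème de Lindemann–Weierstrass*, Acta Arith.
  67 (1994) 29–45, §II (9), (10) p. 41.
-/

noncomputable section

open MvPolynomial Finset Complex

namespace Literature.NumberTheory.Transcendental

namespace LWMeasure

namespace Setup

open Chudnovsky (zl1 l1 wnorm_nonneg)

/-- `x ^ k ≤ exp (k a)` as soon as `0 ≤ x ≤ exp a`. [folklore] -/
private theorem pow_le_exp_of_le {x a : ℝ} (hx : 0 ≤ x) (h : x ≤ Real.exp a) (k : ℕ) :
    x ^ k ≤ Real.exp (k * a) := by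
  rw [Real.exp_nat_mul]
  exact pow_le_pow_left₀ hx h k

/-- `log x ≤ E` for `0 ≤ x ≤ exp E` and `E ≥ 0` (also when `x = 0`, where `log 0 = 0`).
[folklore] -/
private theorem log_le_of_le_exp {x E : ℝ} (hx : 0 ≤ x) (hE : 0 ≤ E) (h : x ≤ Real.exp E) :
    Real.log x ≤ E := by
  rcases hx.eq_or_lt with h0 | h0
  · rw [← h0, Real.log_zero]
    exact hE
  · calc Real.log x ≤ Real.log (Real.exp E) := Real.log_le_log h0 h
      _ = E := Real.log_exp E

/-- **The sizes of the family `{Q_{s,h,j}} ∪ {μ(w)}` at the final parameters** ((9), (10) p. 41):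
there are `M₀` and constants `c_δ, c_τ > 0` (depending on the data and on `c_ST`) such that, under
the parameter relations `M ≥ M₀`, `Mⁿ ≤ L`, `1 ≤ D ≤ 2^{n+4} d`, `1 ≤ b ≤ DM`,
`7L ≤ T'Mⁿ ≤ 8L`, `sMⁿ ≤ c_ST L`, `Mⁿ L log M ≤ R ≤ (5/4) L log L`, `L log L ≤ 4R`, and for
unknowns `|p| ≤ H ≤ LDbⁿ (L+D)^{T'} K₁(M)^L` and a point `h ∈ [0,M)ⁿ`:
`deg Q_{s,h,j} ≤ c_δ M`, `log ‖Q_{s,h,j}‖₁ ≤ c_τ R/Mⁿ`, `deg μ(w) ≤ c_δ M`,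
`log ‖μ(w)‖₁ ≤ c_τ R/Mⁿ` (Ably's (9) `deg Q_{s,h,j} ≤ 2nDM ≤ δ_{c₄}(L,ν)` and (10)
`h(Q_{s,h,j}) ≤ 2φ₂(L,D,M,T) ≤ H_{c₅}(L,ν)`, in the parametrisation `R ≍ L log L`,
`Mⁿ ≍ (log L)^ν` of the main proposition). [cite: Ably1994, §II (9), (10) p. 41] -/
theorem family_sizes (S : Setup) (cST : ℕ) :
    ∃ (M₀ : ℕ) (cδ cτ : ℝ), 0 < cδ ∧ 0 < cτ ∧ ∀ (L D b M T' s : ℕ) (p : Unk S.n L D b → ℤ)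
      (h : Fin S.n → ℕ) (j : Fin (S.n + 1) →₀ ℕ) (H R : ℝ),
      M₀ ≤ M → M ^ S.n ≤ L → 1 ≤ D → D ≤ 2 ^ (S.n + 4) * S.d → 1 ≤ b → b ≤ D * M →
      T' * M ^ S.n ≤ 8 * L → 7 * L ≤ T' * M ^ S.n → s * M ^ S.n ≤ cST * L →
      (M : ℝ) ^ S.n * L * Real.log M ≤ R → R ≤ 5 / 4 * L * Real.log L → L * Real.log L ≤ 4 * R →
      0 ≤ H → H ≤ ((L * D * b ^ S.n : ℕ) : ℝ) * (((L : ℝ) + D) ^ T' * S.K₁ M ^ L) →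
      (∀ w, |(p w : ℝ)| ≤ H) → (∀ k, h k < M) →
      ((S.Qj p h s j).totalDegree : ℝ) ≤ cδ * M ∧
      Real.log (Chudnovsky.l1 (S.Qj p h s j)) ≤ cτ * R / (M : ℝ) ^ S.n ∧
      ((toW S.n S.μ).totalDegree : ℝ) ≤ cδ * M ∧
      Real.log (Chudnovsky.l1 (toW S.n S.μ)) ≤ cτ * R / (M : ℝ) ^ S.n := by
  -- the constants: `Dm = 2^{n+4} d` (the bound for `D`), `cK` with `K₁(M) ≤ cK · M`
  set Dm : ℝ := (2 : ℝ) ^ (S.n + 4) * S.d with hDm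
  set cK : ℝ := |(S.c : ℝ)| * (1 + S.AR) * (1 + zl1 S.μ) ^ S.dR with hcK
  have hAR := S.AR_nonneg
  have hμ0 : 0 ≤ zl1 S.μ := apply_nonneg _ _
  have hDm0 : 0 ≤ Dm := by positivity
  have hcK0 : 0 ≤ cK := by positivity
  have hd0 : (0 : ℝ) < S.d := by exact_mod_cast S.one_le_d
  have hcST0 : (0 : ℝ) ≤ cST := Nat.cast_nonneg _
  refine ⟨3, 2 ^ (S.n + 5) * S.n * S.d + S.d,
    36 + 10 * Dm + 3 * S.n * Dm + 2 * cK + 4 * cST + cST * Dm + zl1 S.μ + 1,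
    by positivity, by positivity, ?_⟩
  intro L D b M T' s p h j H R hM3 hML _hD1 hD2 _hb1 hbDM hT'8 _h7 hsL hR1 _hR2 hR3 hH0 hH hp hh
  have hM1 : 1 ≤ M := le_trans (by norm_num) hM3
  /- degrees, (9) p. 41 -/
  have hdeg : S.n * (b - 1) + (S.d - 1 + (D - 1) * (S.n * (M - 1))) ≤
      (2 ^ (S.n + 5) * S.n * S.d + S.d) * M := by
    have e1 : S.n * (b - 1) ≤ S.n * (2 ^ (S.n + 4) * S.d * M) :=
      Nat.mul_le_mul_left _ ((Nat.sub_le _ _).trans (hbDM.trans (Nat.mul_le_mul_right _ hD2)))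
    have e2 : (D - 1) * (S.n * (M - 1)) ≤ (2 ^ (S.n + 4) * S.d) * (S.n * M) :=
      Nat.mul_le_mul ((Nat.sub_le _ _).trans hD2) (Nat.mul_le_mul_left _ (Nat.sub_le _ _))
    have e3 : S.d - 1 ≤ S.d * M := (Nat.sub_le _ _).trans (Nat.le_mul_of_pos_right _ hM1)
    calc S.n * (b - 1) + (S.d - 1 + (D - 1) * (S.n * (M - 1)))
        ≤ S.n * (2 ^ (S.n + 4) * S.d * M) + (S.d * M + 2 ^ (S.n + 4) * S.d * (S.n * M)) :=
          add_le_add e1 (add_le_add e3 e2)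
      _ = (2 ^ (S.n + 5) * S.n * S.d + S.d) * M := by ring
  have hdegQ : ((S.Qj p h s j).totalDegree : ℝ) ≤ (2 ^ (S.n + 5) * S.n * S.d + S.d : ℝ) * M := by
    have := (S.totalDegree_Qj_le p hh s j).trans hdeg
    exact_mod_cast this
  have hdegμ : ((toW S.n S.μ).totalDegree : ℝ) ≤ (2 ^ (S.n + 5) * S.n * S.d + S.d : ℝ) * M := by
    have h0 : (toW S.n S.μ).totalDegree ≤ S.d * M :=
      (totalDegree_toW_le S.n S.μ).trans (Nat.le_mul_of_pos_right _ hM1)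
    have h1 : ((toW S.n S.μ).totalDegree : ℝ) ≤ (S.d : ℝ) * M := by exact_mod_cast h0
    have h2 : (0 : ℝ) ≤ 2 ^ (S.n + 5) * S.n * S.d * M := by positivity
    linarith
  /- real forms of the hypotheses -/
  have hM3r : (3 : ℝ) ≤ M := by exact_mod_cast hM3
  have hM0 : (0 : ℝ) < M := by linarith
  have hM1r : (1 : ℝ) ≤ M := by linarith
  have hMnL : (M : ℝ) ^ S.n ≤ L := by exact_mod_cast hML
  have hT'8r : (T' : ℝ) * (M : ℝ) ^ S.n ≤ 8 * L := by exact_mod_cast hT'8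
  have hsLr : (s : ℝ) * (M : ℝ) ^ S.n ≤ cST * L := by exact_mod_cast hsL
  have hDDm : (D : ℝ) ≤ Dm := by rw [hDm]; exact_mod_cast hD2
  have hbDMr : (b : ℝ) ≤ D * M := by exact_mod_cast hbDM
  have hkr : ((S.n * (b - 1) : ℕ) : ℝ) ≤ S.n * (D * M) := by
    have : S.n * (b - 1) ≤ S.n * (D * M) := Nat.mul_le_mul_left _ ((Nat.sub_le _ _).trans hbDM)
    exact_mod_cast this
  set Mn : ℝ := (M : ℝ) ^ S.n with hMn
  have hMnM : (M : ℝ) ≤ Mn := le_self_pow₀ hM1r (by have := S.one_le_n; omega)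
  have hMn0 : 0 < Mn := by positivity
  have hMn1 : 1 ≤ Mn := hM1r.trans hMnM
  have hL1 : (1 : ℝ) ≤ L := hMn1.trans hMnL
  have hL0 : (0 : ℝ) < L := by linarith
  have hD0 : (0 : ℝ) ≤ D := Nat.cast_nonneg _
  have hb0 : (0 : ℝ) ≤ b := Nat.cast_nonneg _
  have hT'0 : (0 : ℝ) ≤ T' := Nat.cast_nonneg _
  have hs0 : (0 : ℝ) ≤ s := Nat.cast_nonneg _
  have hn0 : (0 : ℝ) ≤ S.n := Nat.cast_nonneg _
  /- logarithms: `1 ≤ log M ≤ log L ≤ L` -/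
  have hlogM1 : 1 ≤ Real.log M := by
    calc (1 : ℝ) = Real.log (Real.exp 1) := (Real.log_exp 1).symm
      _ ≤ Real.log M :=
          Real.log_le_log (Real.exp_pos 1) (by have := Real.exp_one_lt_d9; linarith)
  have hlogL1 : 1 ≤ Real.log L := hlogM1.trans (Real.log_le_log hM0 (hMnM.trans hMnL))
  have hlogL0 : 0 ≤ Real.log L := by linarith
  have hlogLL : Real.log L ≤ L := Real.log_le_self hL0.le
  /- `X = R / Mⁿ ≥ L log M ≥ L ≥ M`, `X ≥ log L`, `X ≥ 1` -/
  set X : ℝ := R / Mn with hX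
  have hLMX : (L : ℝ) * Real.log M ≤ X := by
    rw [hX, le_div_iff₀ hMn0]
    calc (L : ℝ) * Real.log M * Mn = Mn * L * Real.log M := by ring
      _ ≤ R := hR1
  have hLX : (L : ℝ) ≤ X := (le_mul_of_one_le_right hL0.le hlogM1).trans hLMX
  have hX1 : 1 ≤ X := hL1.trans hLX
  have hX0 : 0 ≤ X := by linarith
  have hMX : (M : ℝ) ≤ X := hMnM.trans (hMnL.trans hLX)
  have hlogLX : Real.log L ≤ X := hlogLL.trans hLX
  have hT'L : (T' : ℝ) ≤ 8 * L := (le_mul_of_one_le_right hT'0 hMn1).trans hT'8r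
  have hsL' : (s : ℝ) ≤ cST * L := (le_mul_of_one_le_right hs0 hMn1).trans hsLr
  /- the linear facts `term ≤ const · X` -/
  have hT'logL : (T' : ℝ) * Real.log L ≤ 32 * X := by
    rw [hX, show (32 : ℝ) * (R / Mn) = 32 * R / Mn by ring, le_div_iff₀ hMn0]
    linarith [mul_le_mul_of_nonneg_right hT'8r hlogL0]
  have hslogL : (s : ℝ) * Real.log L ≤ 4 * cST * X := by
    rw [hX, show (4 : ℝ) * cST * (R / Mn) = 4 * cST * R / Mn by ring, le_div_iff₀ hMn0]
    linarith [mul_le_mul_of_nonneg_right hsLr hlogL0, mul_le_mul_of_nonneg_left hR3 hcST0]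
  have hDX : (D : ℝ) ≤ Dm * X := hDDm.trans (le_mul_of_one_le_right hDm0 hX1)
  have hDMX : (D : ℝ) * M ≤ Dm * X := mul_le_mul hDDm hMX hM0.le hDm0
  have hkX : ((S.n * (b - 1) : ℕ) : ℝ) ≤ S.n * (Dm * X) :=
    hkr.trans (mul_le_mul_of_nonneg_left hDMX hn0)
  have hnbX : (S.n : ℝ) * b ≤ S.n * (Dm * X) := mul_le_mul_of_nonneg_left (hbDMr.trans hDMX) hn0
  have hLDmX : Dm * (L : ℝ) ≤ Dm * X := mul_le_mul_of_nonneg_left hLX hDm0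
  have hT'D : (T' : ℝ) * D ≤ 8 * (Dm * X) := by
    calc (T' : ℝ) * D ≤ (8 * L) * Dm := mul_le_mul hT'L hDDm hD0 (by positivity)
      _ = 8 * (Dm * L) := by ring
      _ ≤ 8 * (Dm * X) := by linarith
  have hsD : (s : ℝ) * D ≤ cST * (Dm * X) := by
    calc (s : ℝ) * D ≤ (cST * L) * Dm := mul_le_mul hsL' hDDm hD0 (by positivity)
      _ = cST * (Dm * L) := by ring
      _ ≤ cST * (Dm * X) := mul_le_mul_of_nonneg_left hLDmX hcST0
  have hLcK : (L : ℝ) * cK ≤ cK * X := by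
    rw [mul_comm]; exact mul_le_mul_of_nonneg_left hLX hcK0
  have hμX : zl1 S.μ ≤ zl1 S.μ * X := le_mul_of_one_le_right hμ0 hX1
  /- each factor of the bounds against an exponential -/
  have hLe : (L : ℝ) ≤ Real.exp (Real.log L) := (Real.exp_log hL0).ge
  have hDe : (D : ℝ) ≤ Real.exp D := by linarith [Real.add_one_le_exp (D : ℝ)]
  have h2e : (2 : ℝ) ^ (S.n * (b - 1)) ≤ Real.exp ((S.n * (b - 1) : ℕ) * 1) :=
    pow_le_exp_of_le zero_le_two (by linarith [Real.add_one_le_exp (1 : ℝ)]) _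
  have hbe : (b : ℝ) ^ S.n ≤ Real.exp (S.n * b) :=
    pow_le_exp_of_le hb0 (by linarith [Real.add_one_le_exp (b : ℝ)]) _
  have hLDe : (L : ℝ) + D ≤ Real.exp (Real.log L + D) := by
    rw [Real.exp_add, Real.exp_log hL0]
    have h1 := mul_le_mul_of_nonneg_left (Real.add_one_le_exp (D : ℝ)) hL0.le
    have h2 := mul_nonneg (sub_nonneg.mpr hL1) hD0
    linarith only [h1, h2]
  have hLD0 : (0 : ℝ) ≤ (L : ℝ) + D := by positivity
  have hLDTe : ((L : ℝ) + D) ^ T' ≤ Real.exp (T' * (Real.log L + D)) :=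
    pow_le_exp_of_le hLD0 hLDe _
  have hLDse : ((L : ℝ) + D) ^ s ≤ Real.exp (s * (Real.log L + D)) :=
    pow_le_exp_of_le hLD0 hLDe _
  have hK0 : 0 ≤ S.K₁ M := zero_le_one.trans (S.one_le_K₁ M)
  have hK₁ : S.K₁ M ≤ Real.exp (cK + Real.log M) := by
    have h1 : S.K₁ M ≤ cK * M := by
      have h2 : 1 + (M : ℝ) * S.AR ≤ M * (1 + S.AR) := by linarith
      calc S.K₁ M = |(S.c : ℝ)| * (1 + M * S.AR) * (1 + zl1 S.μ) ^ S.dR := rfl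
        _ ≤ |(S.c : ℝ)| * (M * (1 + S.AR)) * (1 + zl1 S.μ) ^ S.dR := by gcongr
        _ = cK * M := by rw [hcK]; ring
    rw [Real.exp_add, Real.exp_log hM0]
    exact h1.trans (mul_le_mul_of_nonneg_right (by linarith [Real.add_one_le_exp cK]) hM0.le)
  have hKe : S.K₁ M ^ L ≤ Real.exp (L * (cK + Real.log M)) := pow_le_exp_of_le hK0 hK₁ _
  -- the height of the unknowns
  have hHe : H ≤ Real.exp (Real.log L + D + S.n * b +
      (T' * (Real.log L + D) + L * (cK + Real.log M))) := by
    refine hH.trans ?_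
    push_cast
    calc (L : ℝ) * D * (b : ℝ) ^ S.n * (((L : ℝ) + D) ^ T' * S.K₁ M ^ L)
        ≤ Real.exp (Real.log L) * Real.exp D * Real.exp (S.n * b) *
          (Real.exp (T' * (Real.log L + D)) * Real.exp (L * (cK + Real.log M))) := by gcongr
      _ = _ := by simp only [← Real.exp_add]
  /- (10) p. 41: `‖Q_{s,h,j}‖₁ ≤ exp (c_τ R / Mⁿ)` -/
  have hl1Q : l1 (S.Qj p h s j) ≤ Real.exp (Real.log L + D +
      (((S.n * (b - 1) : ℕ) * 1 + (S.n * b + (Real.log L + D + S.n * b +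
        (T' * (Real.log L + D) + L * (cK + Real.log M))))) +
      (s * (Real.log L + D) + L * (cK + Real.log M)))) := by
    refine (S.l1_Qj_le p hH0 hp hh s j).trans ?_
    calc (L : ℝ) * D * ((2 ^ (S.n * (b - 1)) * ((b : ℝ) ^ S.n * H)) *
          (((L : ℝ) + D) ^ s * S.K₁ M ^ L))
        ≤ Real.exp (Real.log L) * Real.exp D *
          ((Real.exp ((S.n * (b - 1) : ℕ) * 1) * (Real.exp (S.n * b) *
            Real.exp (Real.log L + D + S.n * b +
              (T' * (Real.log L + D) + L * (cK + Real.log M))))) *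
          (Real.exp (s * (Real.log L + D)) * Real.exp (L * (cK + Real.log M)))) := by gcongr
      _ = _ := by simp only [← Real.exp_add]
  have hcτ0 : (0 : ℝ) ≤
      (36 + 10 * Dm + 3 * S.n * Dm + 2 * cK + 4 * cST + cST * Dm + zl1 S.μ + 1) * X := by
    positivity
  have hμX0 : 0 ≤ zl1 S.μ * X := mul_nonneg hμ0 hX0
  refine ⟨hdegQ, ?_, hdegμ, ?_⟩
  · rw [mul_div_assoc, ← hX]
    refine log_le_of_le_exp (wnorm_nonneg _ _) hcτ0 (hl1Q.trans (Real.exp_le_exp.mpr ?_))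
    linarith
  · rw [mul_div_assoc, ← hX]
    refine log_le_of_le_exp (wnorm_nonneg _ _) hcτ0 ?_
    have h36 : (0 : ℝ) ≤ (36 + 10 * Dm + 3 * S.n * Dm + 2 * cK + 4 * cST + cST * Dm + 1) * X := by
      positivity
    calc l1 (toW S.n S.μ) ≤ zl1 S.μ := l1_toW_le _ _
      _ ≤ Real.exp (zl1 S.μ) := by linarith [Real.add_one_le_exp (zl1 S.μ)]
      _ ≤ _ := Real.exp_le_exp.mpr (by linarith)

end Setup

end LWMeasure

end Literature.NumberTheory.Transcendental

end
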